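import Literature.AlgebraicGeometry.HodgeTheory.GAGADimensionCharts
import Literature.AlgebraicGeometry.Motives.CartierDivisorCocycle
import Literature.Geometry.Kaehler.ComplexVectorBundle
import Literature.Geometry.Kaehler.PluriharmonicLog
import HarnessLib

/-!
# The holomorphic line bundle `𝒪_X(D)^an` of a Cartier divisor on an analytification, and the coordinates of its sections

Family `hodge`, layer `Literature/AlgebraicGeometry/HodgeTheory`. For a Cartier divisor
`D = (U_i, f_i)` on an integral scheme `X/ℂ` (`Motives/CartierDivisor`, Görtz–Wedhorn I Def. 11.20)
the line bundle `𝒪_X(D)` is glued from the `𝒪_{U_i}` along the Čech cocycle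
`g_ij = f_i/f_j ∈ Γ(U_i ∩ U_j, 𝒪_X^×)` (`CartierDivisor.transFun`, `Motives/CartierDivisorCocycle`;
Görtz–Wedhorn I (11.9) and Rem. 11.16), a global section `s ∈ Γ(X, 𝒪_X(D)) ⊆ K(X)`
(`CartierDivisor.IsSection`: `f_i s ∈ Γ(U_i, 𝒪_X)`) having the coordinates `s_i = f_i s` with
`s_i = g_ij s_j`. J.-P. Serre, GAGA (1956), §2 n°6: «toute fonction régulière est holomorphe» — on an
analytification `φ : M → X(ℂ)` (`IsAnalytification`) regular functions pull back to holomorphic ones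
(`IsAnalytification.mdifferentiableOn_evalOrZero_opens_holds`) — and §3 n°9 (`ℱ ↦ ℱ^h`): the sheaf
`𝒪_X(D)^h` is the holomorphic line bundle with the SAME cocycle read on `M`. This file records that
transport in the tree's cocycle format (`Geometry/Kaehler/ComplexVectorBundle`, Kobayashi's convention
`ξ_i = g_ij ξ_j` for the coordinates of a section) and PROVES:

* `cartierDivisorCocycle hφ D` — **the holomorphic cocycle `𝒪_X(D)^an` on `M`**: trivialising opens
  `φ⁻¹(U_i(ℂ))`, transition functions `m ↦ g_ij(φ m)`; holomorphic (`cartierDivisorCocycle_isHolomorphic`),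
  the cocycle identities being `g_ii = 1`, `g_ij g_jk = g_ik` evaluated at complex points;
* `CartierDivisor.sectionCoord hφ D hs i : M → ℂ` — the coordinate `m ↦ (f_i s)(φ m)` of a section
  `s` of `𝒪_X(D)` in the frame over `φ⁻¹(U_i(ℂ))`, with: holomorphy on `φ⁻¹(U_i(ℂ))`
  (`mdifferentiableOn_sectionCoord`), the transformation rule `s_j = g_ji s_i`
  (`sectionCoord_eq_mul`), and non-vanishing on `φ⁻¹(X_s(ℂ))`, `X_s` the non-vanishing locus
  `CartierDivisor.nonvanishing s` of `s` (`sectionCoord_ne_zero`) — i.e. **`𝒪_X(D)^an` is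
  holomorphically trivial over `φ⁻¹(X_s(ℂ))`**, the datum consumed by
  `HolomorphicLineBundle.IsTrivialOn` (C. Voisin, *Hodge Theory and Complex Algebraic Geometry I*
  (2002), proof of Thm. 11.33: "`Lᵢ` is trivial on `X − Dᵢ`").

Everything is proved; no named facts.

## References

* [SerreGAGA1956] J.-P. Serre, Géométrie algébrique et géométrie analytique, Ann. Inst. Fourier 6
  (1956), §2 n°6, §3 n°9.
* [GortzWedhorn2020] U. Görtz, T. Wedhorn, Algebraic Geometry I, 2nd ed. (2020), (11.9), Rem. 11.16,
  Def. 11.20.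
* [VoisinHodgeI2002] C. Voisin, Hodge Theory and Complex Algebraic Geometry I (2002), Thm. 11.33 (proof).
-/

noncomputable section

open scoped Manifold ContDiff
open CategoryTheory AlgebraicGeometry TopologicalSpace Opposite
open Literature.AlgebraicGeometry.Motives
open Literature.AlgebraicGeometry.Motives.RatFn
open Literature.AlgebraicGeometry.Motives.AlgPoints
open Literature.NumberTheory.Transcendental
open Literature.Geometry.Kaehler

namespace Literature.AlgebraicGeometry.HodgeTheory

section HodgeTheory

variable {X : SchemeOver ℂ} [IsIntegral X.left] {n : ℕ}
  {E : Type*} [NormedAddCommGroup E] [NormedSpace ℂ E] [FiniteDimensional ℂ E]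
  {M : Type*} [TopologicalSpace M] [ChartedSpace E M] [IsManifold 𝓘(ℂ, E) ω M]
  [IsManifold 𝓘(ℝ, E) ∞ M]
  {φ : M → ComplexPoints X}

/-! ### Evaluation of sections at complex points: two pointwise identities -/

omit [IsIntegral X.left] in
/-- `1 ∈ Γ(U, 𝒪_X)` takes the value `1` at every complex point of `U`. [folklore] -/
theorem evalOrZero_one {U : X.left.Opens} {P : ComplexPoints X} (hP : P.pt ∈ U) :
    evalOrZero U (1 : Γ(X.left, U)) P = 1 := by
  rw [evalOrZero_of_mem _ hP, ← AlgPoints.evalRingHom_apply, map_one]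

omit [IsIntegral X.left] in
/-- `evalOrZero` is multiplicative, pointwise. [folklore] -/
theorem evalOrZero_mul_apply (U : X.left.Opens) (s t : Γ(X.left, U)) (P : ComplexPoints X) :
    evalOrZero U (s * t) P = evalOrZero U s P * evalOrZero U t P :=
  congrFun (GAGADimension.evalOrZero_mul U s t) P

/-! ### The cocycle `𝒪_X(D)^an` -/

/-- The value `g_ij(P) g_jk(P) = g_ik(P)` of the cocycle identity of `𝒪_X(D)` at a complex point of
`U_i ∩ U_j ∩ U_k`. [cite: GortzWedhorn2020, Rem. 11.16 (p. 369)] -/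
theorem _root_.Literature.AlgebraicGeometry.Motives.CartierDivisor.evalOrZero_transFun_mul (D : CartierDivisor X.left) {i j k : D.ι} {P : ComplexPoints X}
    (hi : P.pt ∈ D.U i) (hj : P.pt ∈ D.U j) (hk : P.pt ∈ D.U k) :
    evalOrZero (D.U i ⊓ D.U j) (D.transFun i j) P * evalOrZero (D.U j ⊓ D.U k) (D.transFun j k) P =
      evalOrZero (D.U i ⊓ D.U k) (D.transFun i k) P := by
  have hP : P.pt ∈ D.U i ⊓ D.U j ⊓ D.U k := ⟨⟨hi, hj⟩, hk⟩
  have h := congrArg (fun σ ↦ evalOrZero (D.U i ⊓ D.U j ⊓ D.U k) σ P) (D.transFun_mul_transFun i j k)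
  simp only [evalOrZero_mul_apply] at h
  rwa [evalOrZero_map_homOfLE _ _ hP, evalOrZero_map_homOfLE _ _ hP, evalOrZero_map_homOfLE _ _ hP] at h

/-- `g_ii(P) = 1` at a complex point of `U_i`. [cite: GortzWedhorn2020, Rem. 11.16 (p. 369)] -/
theorem _root_.Literature.AlgebraicGeometry.Motives.CartierDivisor.evalOrZero_transFun_self (D : CartierDivisor X.left) {i : D.ι} {P : ComplexPoints X}
    (hi : P.pt ∈ D.U i) : evalOrZero (D.U i ⊓ D.U i) (D.transFun i i) P = 1 := by
  rw [D.transFun_self i, evalOrZero_one (show P.pt ∈ D.U i ⊓ D.U i from ⟨hi, hi⟩)]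

/-- `g_ij(P) g_ji(P) = 1` at a complex point of `U_i ∩ U_j`. [cite: GortzWedhorn2020, Rem. 11.16 (p. 369)] -/
theorem _root_.Literature.AlgebraicGeometry.Motives.CartierDivisor.evalOrZero_transFun_mul_symm (D : CartierDivisor X.left) {i j : D.ι} {P : ComplexPoints X}
    (hi : P.pt ∈ D.U i) (hj : P.pt ∈ D.U j) :
    evalOrZero (D.U i ⊓ D.U j) (D.transFun i j) P * evalOrZero (D.U j ⊓ D.U i) (D.transFun j i) P = 1 := by
  rw [D.evalOrZero_transFun_mul hi hj hi, D.evalOrZero_transFun_self hi]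

variable (hφ : IsAnalytification E X n φ) (D : CartierDivisor X.left)

/-- **The holomorphic line bundle `𝒪_X(D)^an` on an analytification `φ : M → X(ℂ)`, as a rank-one
cocycle**: trivialising opens `φ⁻¹(U_i(ℂ))`, transition functions the `1 × 1` matrices
`(g_ij(φ m))`, `g_ij = f_i/f_j` the Čech cocycle of `𝒪_X(D)` (Görtz–Wedhorn I (11.9), Rem. 11.16:
in the trivialisations `1 ↦ f_i⁻¹` a section `s` has coordinates `s_i = f_i s`, `s_i = g_ij s_j` — the
rule `ξ_i = g_ij ξ_j` of `ComplexVectorBundle`), read on `M` where they are holomorphic (Serre, GAGA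
§2 n°6) hence real-`C^∞`; cocycle identities `g_ii = 1`, `g_ij g_jk = g_ik`. Serre, GAGA §3 n°9: the
analytic sheaf `𝒪_X(D)^h`. [cite: SerreGAGA1956, §2 n°6 and §3 n°9] [cite: GortzWedhorn2020, Rem. 11.16 (p. 369)] -/
def cartierDivisorCocycle : SmoothComplexVectorBundle D.ι E M 1 where
  baseSet i := φ ⁻¹' {P | P.pt ∈ D.U i}
  isOpen_baseSet i := hφ.isOpen_preimage (D.U i)
  exists_mem_baseSet m := D.covers (φ m).pt
  coordChange i j m := Matrix.of fun _ _ ↦ evalOrZero (D.U i ⊓ D.U j) (D.transFun i j) (φ m)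
  contMDiffOn_coordChange i j _ _ :=
    contMDiffOn_real_of_mdifferentiableOn_complex
      (IsAnalytification.mdifferentiableOn_evalOrZero_opens_holds hφ (D.U i ⊓ D.U j) (D.transFun i j))
      (hφ.isOpen_preimage (D.U i ⊓ D.U j))
  coordChange_self i m hm := by
    ext a b
    rw [Matrix.of_apply, D.evalOrZero_transFun_self hm, Matrix.one_apply, if_pos (Subsingleton.elim a b)]
  coordChange_comp i j k m hm := by
    ext a b
    simp only [Matrix.mul_apply, Matrix.of_apply, Fin.sum_univ_one]
    exact D.evalOrZero_transFun_mul hm.1.1 hm.1.2 hm.2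

/-- The trivialising sets of `𝒪_X(D)^an` (definitional). [folklore] -/
@[simp]
theorem cartierDivisorCocycle_baseSet (i : D.ι) :
    (cartierDivisorCocycle hφ D).baseSet i = φ ⁻¹' {P | P.pt ∈ D.U i} :=
  rfl

/-- The transition functions of `𝒪_X(D)^an` (definitional): `g_ij(φ m)`. [folklore] -/
theorem cartierDivisorCocycle_coordChange_apply (i j : D.ι) (m : M) (a b : Fin 1) :
    (cartierDivisorCocycle hφ D).coordChange i j m a b = evalOrZero (D.U i ⊓ D.U j) (D.transFun i j) (φ m) :=
  rfl

/-- **`𝒪_X(D)^an` is a holomorphic cocycle** (regular functions are holomorphic on an analytification,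
Serre, GAGA §2 n°6). [cite: SerreGAGA1956, §2 n°6] -/
theorem cartierDivisorCocycle_isHolomorphic : (cartierDivisorCocycle hφ D).IsHolomorphic := fun i j _ _ ↦
  IsAnalytification.mdifferentiableOn_evalOrZero_opens_holds hφ (D.U i ⊓ D.U j) (D.transFun i j)

/-! ### Coordinates of a section of `𝒪_X(D)` and the trivialisation over `X_s` -/

variable {s : X.left.functionField} (hs : D.IsSection s)

omit [TopologicalSpace M] in
open scoped Classical in
variable (φ) in
/-- **The coordinate `s_i = f_i s` of the section `s ∈ Γ(X, 𝒪_X(D))` over `φ⁻¹(U_i(ℂ))`**: the value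
at `φ m` of the regular function `f_i s ∈ Γ(U_i, 𝒪_X)` (the section of the rational function `f_i s`,
regular on `U_i` by `IsSection`; junk `0` if `U_i = ∅`). Görtz–Wedhorn I (11.9):
`Γ(V, 𝒪_X(D)) = {f ∈ K(X) ; f_i f ∈ Γ(U_i ∩ V, 𝒪_X)}`. [cite: GortzWedhorn2020, Section (11.9) (p. 374)] -/
def _root_.Literature.AlgebraicGeometry.Motives.CartierDivisor.sectionCoord (i : D.ι) : M → ℂ := fun m ↦
  if h : genericPoint X.left ∈ D.U i then
    evalOrZero (D.U i) (sectionOf h (D.f i * s) fun y hy ↦ hs i y hy) (φ m)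
  else 0

variable {D}

omit [TopologicalSpace M] in
/-- On `φ⁻¹(U_i(ℂ))` the coordinate is the value of the regular function `f_i s`. [folklore] -/
theorem sectionCoord_apply_of_mem {i : D.ι} {m : M} (hm : (φ m).pt ∈ D.U i) :
    D.sectionCoord φ hs i m =
      evalOrZero (D.U i) (sectionOf (genericPoint_mem_of_mem hm) (D.f i * s) fun y hy ↦ hs i y hy) (φ m) := by
  rw [CartierDivisor.sectionCoord, dif_pos (genericPoint_mem_of_mem hm)]

include hφ in
omit [IsManifold 𝓘(ℂ, E) ω M] [IsManifold 𝓘(ℝ, E) ∞ M] in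
/-- **The coordinates of a section are holomorphic** on `φ⁻¹(U_i(ℂ))` (regular functions are
holomorphic, Serre, GAGA §2 n°6). [cite: SerreGAGA1956, §2 n°6] -/
theorem mdifferentiableOn_sectionCoord (i : D.ι) :
    MDifferentiableOn 𝓘(ℂ, E) 𝓘(ℂ, ℂ) (D.sectionCoord φ hs i) (φ ⁻¹' {P | P.pt ∈ D.U i}) := by
  by_cases h : genericPoint X.left ∈ D.U i
  · have heq : D.sectionCoord φ hs i =
        fun m ↦ evalOrZero (D.U i) (sectionOf h (D.f i * s) fun y hy ↦ hs i y hy) (φ m) := by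
      funext m
      rw [CartierDivisor.sectionCoord, dif_pos h]
    rw [heq]
    exact IsAnalytification.mdifferentiableOn_evalOrZero_opens_holds hφ (D.U i) _
  · intro m hm
    exact absurd (genericPoint_mem_of_mem hm) h

omit [TopologicalSpace M] in
/-- **The transformation rule `s_j = g_ji s_i`** on `φ⁻¹((U_i ∩ U_j)(ℂ))`: `f_j s = (f_j/f_i) · (f_i s)`
as regular functions on `U_i ∩ U_j`, evaluated at `φ m`. [cite: GortzWedhorn2020, Section (11.9) and Rem. 11.16] -/
theorem sectionCoord_eq_mul {i j : D.ι} {m : M} (hi : (φ m).pt ∈ D.U i) (hj : (φ m).pt ∈ D.U j) :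
    D.sectionCoord φ hs j m =
      evalOrZero (D.U j ⊓ D.U i) (D.transFun j i) (φ m) * D.sectionCoord φ hs i m := by
  have hW : (φ m).pt ∈ D.U i ⊓ D.U j := ⟨hi, hj⟩
  have hgen : genericPoint X.left ∈ D.U i ⊓ D.U j := genericPoint_mem_of_mem hW
  -- the identity of sections over `U_i ∩ U_j`
  have hsec : X.left.presheaf.map (homOfLE (inf_le_right : D.U i ⊓ D.U j ≤ D.U j)).op
      (sectionOf (genericPoint_mem_of_mem hj) (D.f j * s) fun y hy ↦ hs j y hy) =
      X.left.presheaf.map (homOfLE (le_inf inf_le_right inf_le_left : D.U i ⊓ D.U j ≤ D.U j ⊓ D.U i)).op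
          (D.transFun j i) *
        X.left.presheaf.map (homOfLE (inf_le_left : D.U i ⊓ D.U j ≤ D.U i)).op
          (sectionOf (genericPoint_mem_of_mem hi) (D.f i * s) fun y hy ↦ hs i y hy) := by
    refine section_ext fun h ↦ ?_
    simp only [map_mul, ofSection_map, ofSection_sectionOf, CartierDivisor.ofSection_transFun]
    rw [← mul_assoc, div_mul_cancel₀ _ (D.f_ne_zero i)]
  have h := congrArg (fun σ ↦ evalOrZero (D.U i ⊓ D.U j) σ (φ m)) hsec
  simp only [evalOrZero_mul_apply] at h
  rw [evalOrZero_map_homOfLE _ _ hW, evalOrZero_map_homOfLE _ _ hW, evalOrZero_map_homOfLE _ _ hW] at h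
  rw [sectionCoord_apply_of_mem hs hj, sectionCoord_apply_of_mem hs hi]
  exact h

omit [TopologicalSpace M] in
/-- **The coordinates do not vanish over the non-vanishing locus `X_s`**: for `φ m ∈ (U_i ∩ X_s)(ℂ)`,
`(f_i s)(φ m) ≠ 0` (`f_i s` is a unit of `𝒪_{X, φ m}`, i.e. `φ m ∈ X_{f_i s}`, and a regular function
takes a non-zero value at the complex points of its basic open set).
[cite: GortzWedhorn2020, (7.11) and Remark 13.46 (`X_s`)] -/
theorem sectionCoord_ne_zero {i : D.ι} {m : M} (hi : (φ m).pt ∈ D.U i) (hm : (φ m).pt ∈ D.nonvanishing s) :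
    D.sectionCoord φ hs i m ≠ 0 := by
  rw [sectionCoord_apply_of_mem hs hi, evalOrZero_of_mem _ hi]
  refine (pt_mem_basicOpen_iff (φ m) hi _).1 ?_
  rw [← isUnitAt_ofSection_iff hi, ofSection_sectionOf]
  exact (CartierDivisor.mem_nonvanishing_iff hi).1 hm

include hφ in
omit hs [IsManifold 𝓘(ℂ, E) ω M] [IsManifold 𝓘(ℝ, E) ∞ M] in
/-- The preimage of `X_s(ℂ)` is open in `M`. [folklore] -/
theorem isOpen_preimage_nonvanishing (D : CartierDivisor X.left) (t : X.left.functionField) :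
    IsOpen (φ ⁻¹' {P | P.pt ∈ D.nonvanishing t}) :=
  hφ.isOpen_preimage (D.nonvanishingOpens t)

end HodgeTheory

end Literature.AlgebraicGeometry.HodgeTheory
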